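import Mathlib
import HarnessLib
import Summits.HubbardSuperconductivity.HubbardSuperconductivity.Theorems.WeakCouplingBCSDefsKlCertB1gT
import Summits.HubbardSuperconductivity.HubbardSuperconductivity.Theorems.WeakCouplingBCSWcbcsKohnLuttingerB1gKlCertFormD

/-!
# Route `WeakCouplingBCS` — certificate vocabulary for `WcbcsKohnLuttingerB1g` (stmt-HubbardSuperconductivity-0158):
# the `t′`-PARAMETRISED twins of the certificate predicates (located item «(KLSCAN)-TPRIME-VOCAB»)

The certificate vocabulary of the two Kohn–Luttinger routes (`Theorems/ChiralWindowDefs.lean`: `KLBlock.baseKernel`,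
`KLBlock.sectorKernel`, `KLBlock.Enclosure`; `Theorems/WeakCouplingBCSDefs.lean`: `KLBlock.RitzEnclosure`,
`KLCert.EnclosuresB1g`; `Theorems/WeakCouplingBCSDefsKlCertB1gT.lean`: `KLCert.EnclosuresB1gT`) hard-wires the
nearest-neighbour band `squareDispersion 1 0`.  The Literature layer underneath is already generic in the dispersion
(`squareDispersion (t t' : ℝ)`, `fermiCurveMeasure ε μ`, `lindhardFunction ε μ`, `channelInf ε μ U χ`,
`KohnLuttinger.filling ε μ`, `chemicalPotentialOfDensity ε n` of `Literature/…/KohnLuttinger.lean`), so a certificate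
row for the `t`–`t′` band `ε_{t′}(k) = −2(cos k₀ + cos k₁) − 4t′ cos k₀ cos k₁ = squareDispersion 1 t′` needs only the
dispersion-parametrised twins of those PREDICATES, on the SAME rational record types `KLTrig` / `KLBlock` / `KLBox` /
`KLCert` (their data and their kernel-decidable bookkeeping `ritzOK`, `templeOK`, `farOKd`, `lowerOKd`, `lower`, `upper`,
`b1gLeadsOK`, `chainOK`, `checkB1gD` mention no dispersion and are reused unchanged).  This file is ADDITIVE: it touches
no existing declaration, defines no `instance` and no `notation`, and every twin REDUCES AT `t′ = 0` TO THE EXISTING OBJECT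
BY NAME (definitionally), so every landed `t′ = 0` certificate re-instantiates verbatim.

Naming: suffix `TP` («t-prime»); the suffix `T` is taken by the two-sided records (`KLCert.EnclosuresB1gT`).  The hopping
`t′` is a real parameter `tp : ℝ` placed right after the record argument, so that `X.fooTP 0 = X.foo`.

* §1 kernels: `KLBlock.baseKernelTP b tp μ k q = [withU] + χ₀(k + q; μ)` for `ε_{t′}`, `KLBlock.sectorKernelTP` (the `D₄`
  sector kernel over it); `baseKernelTP_zero`, `sectorKernelTP_zero` (`rfl`).
* §2 enclosure predicates (interface E1–E4 of `Cruxes/CwKLChiralWindow/CertInterface.md`, integrals against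
  `fermiCurveMeasure (squareDispersion 1 tp) μ`): `KLBlock.EnclosureTP`, `KLBlock.RitzEnclosureTP`, and the named numerical
  hypotheses of a record at hopping `t′`: `KLCert.EnclosuresB1gTP` (selection records) and `KLCert.EnclosuresB1gTTP`
  (two-sided records); `…TP_zero : …TP 0 ↔ …` (`Iff.rfl`) for each.
* §3 the table conventions of the scan «KL-MARGIN-SCAN» (cell `gate-hubbard-kl`, HOME/margin-1-g14/SCAN-TABLE-v0.md):
  `klMuOfDopingTP tp δ := chemicalPotentialOfDensity (squareDispersion 1 tp) (1 − δ)` (the free-band chemical potential at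
  hole doping `δ`, as in `Theses.WeakCouplingBCS.WcbcsKohnLuttingerB1g` / `Theses.KLProgramme.MuOfDopingWindow` at `t′ = 0`),
  `klDopingOfMuTP tp μ := 1 − filling`, the van Hove level `klVanHoveLevelTP tp := 4t′ = ε_{t′}(π, 0)` (proved:
  `squareDispersion_one_saddle`) with its doping `klVanHoveDopingTP`, and the VAN HOVE EXCLUSION convention
  `klVHExcludedTP tp δ :↔ |μ(δ; t′) − 4t′| < 1/40` (director 2026-08-28: such cells never carry a certified word — the
  Fermi-curve measure `ds/|∇ε|` is infinite at the saddles, outside the weak-coupling frame); no theorem is claimed about it.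
* §4 the shape of a `t′` row's CONCLUSION: `KLB1gDominatesAtTP tp a b γ` (`U = 1`: `channelInf ε_{t′} μ 1 B1g + γ ≤
  channelInf ε_{t′} μ 1 χ` for `χ ≠ B1g`, uniformly in `μ ∈ [a, b]`) and `KLB1gDominatesTP tp a b γ` (every `0 < U < 1`, margin
  `γU²`), with the `t′ = 0` BRIDGES `klB1gDominatesAtTP_zero_of_checkB1gD` / `klB1gDominatesTP_zero_of_checkB1gD`: an accepted
  record (`checkB1gD = true`) with `EnclosuresB1gTP 0` yields them — literally `klb1gd_window` / `klb1gd_window_U` of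
  `…WcbcsKohnLuttingerB1gKlCertFormD`, i.e. the existing certificates ARE the `t′ = 0` rows of the parametrised vocabulary.

What this file does NOT do (located follow-ups, not claimed): (a) the SOUNDNESS at `t′ ≠ 0`
(`checkB1gD`-type bookkeeping `∧ EnclosuresB1gTP c tp → KLB1gDominatesAtTP tp mub mua gamma`) — the tree's block/box
soundness (`stub_klBlockBounds`, `klb1gd_box_certificate`, finiteness of the Fermi-curve measure, `D₄`-invariance, the
Hilbert–Schmidt property) is proved for `squareDispersion 1 0` on `μ ∈ (−4, 0)` only; for `t′ ≠ 0` the regular range is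
`μ ∈ (−4 − 4t′, 4 − 4t′) ∖ {4t′}` and the box-range clause of a `t′` checker must exclude the van Hove level; (b) the certified
`χ₀` engine for the `t`–`t′` band (kit job «CERT-SREP-t′», margin-1); (c) any record at `t′ ≠ 0`; (d) the trial / deflation functions
are REUSED UNCHANGED: `KLTrig.toFun` evaluates a trigonometric polynomial of the polar angle ABOUT `Γ = (0,0)` of the representative
`k ∈ [−π, π)²`, and `d4Project` / `channelInf` act by `D₄` about `Γ` — the `t′ = 0` semantics verbatim, adequate for `Γ`-centred Fermi curves
(`μ < 4t′` at `t′ < 0`); `M`-centred Fermi pockets (`μ > 4t′` at `t′ < 0`) are to be certified through the REFLECTED `Γ`-centred cell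
`(−t′, −μ)` (particle–hole ⊗ `(π, π)`-shift: `ε_{t′}(k + (π,π)) = −ε_{−t′}(k)`), a lemma NOT in this file («(KLSCAN)-TPRIME-PH-REFLECTION»,
refuter hubbard-klscan-crit-1, 2026-08-28).  Nothing here asserts a margin at any `t′`, the window, or superconductivity.

References: S. Raghu, S. A. Kivelson, D. J. Scalapino, Phys. Rev. B 81 (2010) 224505, §II (4)–(7), (13), §III (17) and
Fig. 3 (`t′ ≠ 0`); W. Kohn, J. M. Luttinger, Phys. Rev. Lett. 15 (1965) 524; M. Reed, B. Simon, *Methods of Modern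
Mathematical Physics IV*, Thm. XIII.5.
-/

noncomputable section

namespace Summit.HubbardSuperconductivity.HubbardSuperconductivity.Theorems.CwKLChiralWindow

set_option linter.dupNamespace false -- summit = problem name (single-conjunct summit), D-0017

open MeasureTheory Literature.MathematicalPhysics.QuantumLattice

/-! ### §1 The `t′`-parametrised kernels of a block -/

/-- The base kernel of the block for the `t`–`t′` band `ε_{t′} = squareDispersion 1 tp`: `χ₀(k + q; μ)` (the static Lindhard
function of `ε_{t′}` at `μ`), plus the bare-`U = 1` constant `1` if `withU`.  At `tp = 0` this is `KLBlock.baseKernel`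
(`baseKernelTP_zero`). [cite: RaghuKivelsonScalapino2010, §II (5), (7) and §III] -/
def KLBlock.baseKernelTP (b : KLBlock) (tp μ : ℝ) (k q : Momentum) : ℝ :=
  (if b.withU then 1 else 0) + lindhardFunction (squareDispersion 1 tp) μ (k + q)

/-- The `D₄`-sector kernel over the `t′` base kernel: `K_χ(k, k') = (dim χ / 8) Σ_g χ(g) κ_{t′}(k, g k')` (the `t′` term
`−4t′ cos k₀ cos k₁` is `D₄`-invariant, so the sectors are the same).  At `tp = 0` this is `KLBlock.sectorKernel`.
[cite: RaghuKivelsonScalapino2010, §III (17)] -/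
def KLBlock.sectorKernelTP (b : KLBlock) (tp μ : ℝ) (χ : D4Irrep) (k k' : Momentum) : ℝ :=
  d4Project χ (fun q => b.baseKernelTP tp μ k q) k'

/-- **Reduction at `t′ = 0`**: the `t′` base kernel at `tp = 0` IS `KLBlock.baseKernel` (definitionally). [folklore] -/
theorem KLBlock.baseKernelTP_zero (b : KLBlock) : b.baseKernelTP 0 = b.baseKernel := rfl

/-- **Reduction at `t′ = 0`**: the `t′` sector kernel at `tp = 0` IS `KLBlock.sectorKernel` (definitionally). [folklore] -/
theorem KLBlock.sectorKernelTP_zero (b : KLBlock) : b.sectorKernelTP 0 = b.sectorKernel := rfl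

/-! ### §2 The `t′`-parametrised enclosure predicates (interface E1–E4) and the named numerical hypotheses of a record -/

/-- **The enclosure statements of a block at hopping `t′`** (interface E1–E4), at the level `μ` in the channel `χ`: with
`σ = fermiCurveMeasure (squareDispersion 1 tp) μ`, `Φ` the trial, `F(k) = ∫ κ_{t′}(k,k') Φ(k') dσ`: if the trial is used then
`Nlo ≤ ∫Φ² ≤ Nhi`, `Qlo ≤ ∫ Φ F ≤ Qhi`, `∫ F² ≤ Thi`; and always `∫∫ (K_χ − Σ c u⊗u)² d(σ⊗σ) ≤ Hhi`.  At `tp = 0` this is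
`KLBlock.Enclosure` (`enclosureTP_zero`). [folklore] -/
def KLBlock.EnclosureTP (b : KLBlock) (tab : List KLTrig) (tp μ : ℝ) (χ : D4Irrep) : Prop :=
  (b.useTrial = true →
    (b.Nlo : ℝ) ≤ ∫ k, b.trialFun tab k ^ 2 ∂fermiCurveMeasure (squareDispersion 1 tp) μ ∧
    ∫ k, b.trialFun tab k ^ 2 ∂fermiCurveMeasure (squareDispersion 1 tp) μ ≤ (b.Nhi : ℝ) ∧
    (b.Qlo : ℝ) ≤ ∫ k, b.trialFun tab k *
        ∫ k', b.baseKernelTP tp μ k k' * b.trialFun tab k' ∂fermiCurveMeasure (squareDispersion 1 tp) μ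
        ∂fermiCurveMeasure (squareDispersion 1 tp) μ ∧
    ∫ k, b.trialFun tab k *
        ∫ k', b.baseKernelTP tp μ k k' * b.trialFun tab k' ∂fermiCurveMeasure (squareDispersion 1 tp) μ
        ∂fermiCurveMeasure (squareDispersion 1 tp) μ ≤ (b.Qhi : ℝ) ∧
    ∫ k, (∫ k', b.baseKernelTP tp μ k k' * b.trialFun tab k' ∂fermiCurveMeasure (squareDispersion 1 tp) μ) ^ 2
        ∂fermiCurveMeasure (squareDispersion 1 tp) μ ≤ (b.Thi : ℝ)) ∧
  ∫ z, (b.sectorKernelTP tp μ χ z.1 z.2 - b.deflKernel tab z.1 z.2) ^ 2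
      ∂(fermiCurveMeasure (squareDispersion 1 tp) μ).prod (fermiCurveMeasure (squareDispersion 1 tp) μ) ≤ (b.Hhi : ℝ)

/-- **The Ritz enclosures of a block at hopping `t′`** (interface E1–E2): `Nlo ≤ ∫Φ² dσ ≤ Nhi` and
`Qlo ≤ ∫ Φ(k) (∫ κ_{t′}(k,k') Φ(k') dσ) dσ ≤ Qhi`, `σ = fermiCurveMeasure (squareDispersion 1 tp) μ`.  At `tp = 0` this is
`KLBlock.RitzEnclosure` (`ritzEnclosureTP_zero`). [folklore] -/
def KLBlock.RitzEnclosureTP (b : KLBlock) (tab : List KLTrig) (tp μ : ℝ) : Prop :=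
  (b.Nlo : ℝ) ≤ ∫ k, b.trialFun tab k ^ 2 ∂fermiCurveMeasure (squareDispersion 1 tp) μ ∧
  ∫ k, b.trialFun tab k ^ 2 ∂fermiCurveMeasure (squareDispersion 1 tp) μ ≤ (b.Nhi : ℝ) ∧
  (b.Qlo : ℝ) ≤ ∫ k, b.trialFun tab k *
      ∫ k', b.baseKernelTP tp μ k k' * b.trialFun tab k' ∂fermiCurveMeasure (squareDispersion 1 tp) μ
      ∂fermiCurveMeasure (squareDispersion 1 tp) μ ∧
  ∫ k, b.trialFun tab k *
      ∫ k', b.baseKernelTP tp μ k k' * b.trialFun tab k' ∂fermiCurveMeasure (squareDispersion 1 tp) μ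
      ∂fermiCurveMeasure (squareDispersion 1 tp) μ ≤ (b.Qhi : ℝ)

/-- **The named numerical hypothesis of a SELECTION record at hopping `t′`** (twin of `KLCert.EnclosuresB1g`): on every box of
the record and for every `μ` in the box, the Ritz enclosures E1–E2 of the `B1g` block and the block enclosures E1–E4 of the
blocks of `A1g, A2g, B2g, E`, all for `ε_{t′} = squareDispersion 1 tp`.  Every conjunct is an inequality between an explicit
integral against the tree's Fermi-curve measure of `ε_{t′}` and a rational of the record (the object of a certified
interval-arithmetic computation).  At `tp = 0` this is `KLCert.EnclosuresB1g` (`enclosuresB1gTP_zero`). [folklore] -/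
def KLCert.EnclosuresB1gTP (c : KLCert) (tp : ℝ) : Prop :=
  ∀ bx ∈ c.boxes, ∀ μ ∈ Set.Icc (bx.mulo : ℝ) (bx.muhi : ℝ),
    bx.bB1g.RitzEnclosureTP c.trials tp μ ∧
      ∀ χ : D4Irrep, χ ≠ D4Irrep.B1g → (bx.blk χ).EnclosureTP c.trials tp μ χ

/-- **The named numerical hypothesis of a TWO-SIDED record at hopping `t′`** (twin of `KLCert.EnclosuresB1gT`): on every box
and for every `μ` in the box, the block enclosures E1–E4 of the blocks of all five channels, for `ε_{t′} = squareDispersion 1 tp`.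
At `tp = 0` this is `KLCert.EnclosuresB1gT` (`enclosuresB1gTTP_zero`). [folklore] -/
def KLCert.EnclosuresB1gTTP (c : KLCert) (tp : ℝ) : Prop :=
  ∀ bx ∈ c.boxes, ∀ μ ∈ Set.Icc (bx.mulo : ℝ) (bx.muhi : ℝ), ∀ χ : D4Irrep, (bx.blk χ).EnclosureTP c.trials tp μ χ

/-- **Reduction at `t′ = 0`**: `b.EnclosureTP tab 0 μ χ ↔ b.Enclosure tab μ χ` (definitionally the same statement). [folklore] -/
theorem KLBlock.enclosureTP_zero (b : KLBlock) (tab : List KLTrig) (μ : ℝ) (χ : D4Irrep) :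
    b.EnclosureTP tab 0 μ χ ↔ b.Enclosure tab μ χ := Iff.rfl

/-- **Reduction at `t′ = 0`**: `b.RitzEnclosureTP tab 0 μ ↔ b.RitzEnclosure tab μ` (definitionally the same statement).
[folklore] -/
theorem KLBlock.ritzEnclosureTP_zero (b : KLBlock) (tab : List KLTrig) (μ : ℝ) :
    b.RitzEnclosureTP tab 0 μ ↔ b.RitzEnclosure tab μ := Iff.rfl

/-- **Reduction at `t′ = 0`**: `c.EnclosuresB1gTP 0 ↔ c.EnclosuresB1g` — the parametrised hypothesis at `t′ = 0` IS the named
numerical hypothesis every landed selection record (`klCertB1gWin*`, `klCertB1gD010`, …) is stated with. [folklore] -/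
theorem KLCert.enclosuresB1gTP_zero (c : KLCert) : c.EnclosuresB1gTP 0 ↔ c.EnclosuresB1g := Iff.rfl

/-- **Reduction at `t′ = 0`**: `c.EnclosuresB1gTTP 0 ↔ c.EnclosuresB1gT` (the two-sided records `klCertB1gWin{A,B,C}T`).
[folklore] -/
theorem KLCert.enclosuresB1gTTP_zero (c : KLCert) : c.EnclosuresB1gTTP 0 ↔ c.EnclosuresB1gT := Iff.rfl

end Summit.HubbardSuperconductivity.HubbardSuperconductivity.Theorems.CwKLChiralWindow

namespace Summit.HubbardSuperconductivity.HubbardSuperconductivity.Theorems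

-- the tree's namespace `Summit.<Summit>.<Problem>.Theorems` repeats the summit name by design (D-0017)
set_option linter.dupNamespace false

open CwKLChiralWindow Literature.MathematicalPhysics.QuantumLattice

/-! ### §3 The conventions of the `(δ, t′)` scan table -/

/-- The free-band chemical potential at hole doping `δ` for the `t`–`t′` band: `μ(δ; t′) := chemicalPotentialOfDensity ε_{t′} (1 − δ)`
(density `n = 1 − δ` per site).  At `tp = 0` it is the term of `Theses.WeakCouplingBCS.WcbcsKohnLuttingerB1g` and of
`Theses.KLProgramme.MuOfDopingWindow` (`klMuOfDopingTP_zero`). [cite: RaghuKivelsonScalapino2010, §II (4)] -/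
def klMuOfDopingTP (tp δ : ℝ) : ℝ :=
  chemicalPotentialOfDensity (squareDispersion 1 tp) (1 - δ)

/-- The hole doping of a chemical potential for the `t`–`t′` band: `δ(μ; t′) := 1 − n(μ)`, `n = KohnLuttinger.filling ε_{t′} μ`.
[cite: RaghuKivelsonScalapino2010, §II (4)] -/
def klDopingOfMuTP (tp μ : ℝ) : ℝ :=
  1 - KohnLuttinger.filling (squareDispersion 1 tp) μ

/-- The van Hove level of the `t`–`t′` band: `μ_VH(t′) := 4t′`, the value of `ε_{t′}` at the saddle points `(π, 0)`, `(0, π)`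
(`squareDispersion_one_saddle`); there the Fermi curve passes through the saddles and its density-of-states measure `ds/|∇ε|`
is infinite. [cite: RaghuKivelsonScalapino2010, §III] -/
def klVanHoveLevelTP (tp : ℝ) : ℝ := 4 * tp

/-- The van Hove doping `δ_VH(t′) := δ(4t′; t′)` (float: `0.082 / 0.170 / 0.274` at `t′ = −0.1 / −0.2 / −0.3`; not asserted here). [folklore] -/
def klVanHoveDopingTP (tp : ℝ) : ℝ := klDopingOfMuTP tp (klVanHoveLevelTP tp)

/-- **The van Hove exclusion convention of the scan table** (director-hubbard 2026-08-28, adopted): the cell `(δ, t′)` is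
«VH-EXCLUDED» iff `|μ(δ; t′) − 4t′| < 0.025 = 1/40` — such cells never carry a certified word (the smooth-Fermi-curve frame does
not apply in a neighbourhood of the van Hove level).  A definition only; no theorem is claimed about it. [folklore] -/
def klVHExcludedTP (tp δ : ℝ) : Prop :=
  |klMuOfDopingTP tp δ - klVanHoveLevelTP tp| < 1 / 40

/-- `ε_{t′}(π, 0) = 4t′`: the `t`–`t′` dispersion at the saddle point `(π, 0)` equals the van Hove level. [folklore] -/
theorem squareDispersion_one_saddle (tp : ℝ) :
    squareDispersion 1 tp (WithLp.toLp 2 ![Real.pi, 0]) = klVanHoveLevelTP tp := by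
  simp [squareDispersion, klVanHoveLevelTP]

/-- **Reduction at `t′ = 0`**: `μ(δ; 0)` IS the chemical-potential term of `WcbcsKohnLuttingerB1g` / `MuOfDopingWindow`. [folklore] -/
theorem klMuOfDopingTP_zero (δ : ℝ) :
    klMuOfDopingTP 0 δ = chemicalPotentialOfDensity (squareDispersion 1 0) (1 - δ) := rfl

/-! ### §4 The conclusion of a `t′` row, and the `t′ = 0` bridges to the landed certificates -/

/-- **`B1g` dominance at `U = 1` on a `μ`-window for the `t`–`t′` band** (the shape a certified `t′` row concludes): for every
`μ ∈ [a, b]` and every channel `χ ≠ B1g`, `channelInf ε_{t′} μ 1 B1g + γ ≤ channelInf ε_{t′} μ 1 χ` — the `d_{x²−y²}` bottom of the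
second-order Kohn–Luttinger vertex lies by `γ` below the four other channel bottoms, uniformly on the window. [cite: RaghuKivelsonScalapino2010, §II (7), (13)] -/
def KLB1gDominatesAtTP (tp a b γ : ℝ) : Prop :=
  ∀ μ ∈ Set.Icc a b, ∀ χ : D4Irrep, χ ≠ D4Irrep.B1g →
    channelInf (squareDispersion 1 tp) μ 1 D4Irrep.B1g + γ ≤ channelInf (squareDispersion 1 tp) μ 1 χ

/-- **`B1g` dominance at every weak coupling on a `μ`-window for the `t`–`t′` band**: for `μ ∈ [a, b]`, `0 < U < 1` and `χ ≠ B1g`,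
`channelInf ε_{t′} μ U B1g + γU² ≤ channelInf ε_{t′} μ U χ`. [cite: RaghuKivelsonScalapino2010, §II (7), (13)] -/
def KLB1gDominatesTP (tp a b γ : ℝ) : Prop :=
  ∀ μ ∈ Set.Icc a b, ∀ U ∈ Set.Ioo (0 : ℝ) 1, ∀ χ : D4Irrep, χ ≠ D4Irrep.B1g →
    channelInf (squareDispersion 1 tp) μ U D4Irrep.B1g + γ * U ^ 2 ≤ channelInf (squareDispersion 1 tp) μ U χ

/-- **`t′ = 0` bridge (U = 1)**: a record accepted by the multiplicity-aware checker whose `t′ = 0` parametrised enclosures hold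
certifies `KLB1gDominatesAtTP 0 mub mua gamma` — verbatim `klb1gd_window` (the existing certificates are the `t′ = 0` rows).
[cite: RaghuKivelsonScalapino2010, §III Fig. 2] -/
theorem klB1gDominatesAtTP_zero_of_checkB1gD (c : KLCert) (hc : c.checkB1gD = true) (hE : c.EnclosuresB1gTP 0) :
    KLB1gDominatesAtTP 0 ((c.mub : ℚ) : ℝ) ((c.mua : ℚ) : ℝ) ((c.gamma : ℚ) : ℝ) :=
  klb1gd_window c hc ((KLCert.enclosuresB1gTP_zero c).1 hE)

/-- **`t′ = 0` bridge (all `0 < U < 1`)**: likewise `KLB1gDominatesTP 0 mub mua gamma` — verbatim `klb1gd_window_U`.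
[cite: RaghuKivelsonScalapino2010, §III Fig. 2] -/
theorem klB1gDominatesTP_zero_of_checkB1gD (c : KLCert) (hc : c.checkB1gD = true) (hE : c.EnclosuresB1gTP 0) :
    KLB1gDominatesTP 0 ((c.mub : ℚ) : ℝ) ((c.mua : ℚ) : ℝ) ((c.gamma : ℚ) : ℝ) :=
  klb1gd_window_U c hc ((KLCert.enclosuresB1gTP_zero c).1 hE)

end Summit.HubbardSuperconductivity.HubbardSuperconductivity.Theorems

end
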